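import Summits.AtomisticToContinuum.HydrodynamicLimit.Theorems.CollisionIsometryCLTCollisionalTransferLocalityDefsE
import Summits.AtomisticToContinuum.HydrodynamicLimit.Theorems.CollisionIsometryCLTCollisionalTransferLocalityMomentumMarkSum
import HarnessLib

/-!
# [DψA] The `A`-weighted flux-form mark sum IS one half of the even collision sums
(line `hemisphere-affine-slaving`, crux `CollisionalTransferLocality`, stmt-AtomisticToContinuum-9518)

Registered helper stub `stub_markSumA_eq_evenCollisionSums` of the line lead (gen 1, seat c10): the matrix-weight
twin of `stub_momentumMarkSum_eq_evenCollisionSums` (`…MomentumMarkSum`, the case `A = ∇ψ`).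
DETERMINISTIC collision bookkeeping on ONE good hard-sphere orbit (no probability). With the window cutoff
`g(a) = max 0 (min 1 (2 − 2a/η_c))` (`= 1` on `[0, η_c/2]`), an ARBITRARY matrix weight
`A : ℝ → 𝕋³ → (Fin 3 → Fin 3 → ℝ)` (weights `χ_ab(s, x) = A(s, x)_ab`) and the even marks `Ξ^{ab} = evenMark a b`,
for `0 ≤ τ ≤ τ' ≤ t`, under the mollified ceiling `ρ_r(Φ_s z, ·) ≤ 2` on `[0, t]` and `4σ³ ≤ η_c`:

  `M_N^A(τ') − M_N^A(τ) = ½ Σ_{a,b} (K_ab(τ') − K_ab(τ))`,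

`M_N^A = MfunA σ Φ A` the flux-form mark sum with weight `A` (`…DefsE`) and
`K_ab(τ) = collisionSum σ N (Φ N) τ χ_ab g Ξ^{ab} r z` the even collision sums of `EvenStressEnskog`.

Collision by collision: both sides are finite sums over the collision times in `(τ, τ']` of sums over the ordered
contact pairs (`collisionPairSum_Ioc_split`, `HardSphereFlow.collisionPairSum_eq_finsum_ite`,
`Icc 0 τ' = Icc 0 τ ∪ Ioc τ τ'`); at an ordered contact pair `(i, j)` of the OUTGOING post-collisional configuration
(`IsHardSphereTrajectory.isOutgoing_of_mem_contactSet`) the pre-collisional velocities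
`(v_i⁻, v_j⁻) = reflectVel n (v_i, v_j)` satisfy `⟪v_j⁻ − v_i⁻, n̂⟫ = ⟪v_i − v_j, n̂⟫ = ‖Δv_i‖ > 0`
(`inner_reflectVel_fst_sub_snd`, `norm_dV_eq`) and `n̂ = ω` at contact, so that
`g(σ³ρ_r(x_i)) Ξ^{ab}(n̂, v_i⁻, v_j⁻) = ‖Δv_i‖ ω_a ω_b` (`g = 1` by the ceiling); hence
`markA σ A = (ε/2)‖Δv_i‖ Σ_ab ω_a ω_b A(s, x_i)_ab = (ε/2) Σ_ab χ_ab g Ξ^{ab}` per ordered collision (no `χ`-term: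
the `A`-weighted kernel has no energy channel), and the finite sums over `(a, b)` and over the collisions commute.
References: Chapman–Cowling (1970) Ch. 16 (collisional transfer of momentum); Cercignani–Illner–Pulvirenti (1994) §4.2.
-/

namespace Summit.AtomisticToContinuum.HydrodynamicLimit.Theorems.HemisphereAffineSlaving

open scoped BigOperators Topology Classical ENNReal InnerProductSpace
open Filter Set Function MeasureTheory
open Literature.Analysis.FunctionSpaces Literature.Analysis.FluidPDE

noncomputable section

open Literature.MathematicalPhysics.KineticTheory (T3 V3 hsDiameter hsDiameter_pos evenMark mollDensity)

/-! ## One ordered contact pair -/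

section OnePairA

/-- The window cutoff under the ceiling: `g(σ³ m) = max 0 (min 1 (2 − 2σ³m/η_c)) = 1` for `m ≤ 2`, `4σ³ ≤ η_c`
(`0 < σ`, `0 < η_c`; re-proved here because `…WindowDomination` is not importable). [folklore] -/
private theorem windowCutoff_ceiling_eq_oneA {σ ηc m : ℝ} (hσ : 0 < σ) (hηc : 0 < ηc) (hσc : 4 * σ ^ 3 ≤ ηc)
    (hm : m ≤ 2) : max 0 (min 1 (2 - 2 * (σ ^ 3 * m) / ηc)) = 1 := by
  have hσ3 : 0 < σ ^ 3 := by positivity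
  have h2 : σ ^ 3 * m ≤ σ ^ 3 * 2 := mul_le_mul_of_nonneg_left hm hσ3.le
  have h1 : 2 * (σ ^ 3 * m) / ηc ≤ 1 := (div_le_one hηc).2 (by linarith)
  rw [min_eq_left (by linarith), max_eq_right zero_le_one]

/-- **The cut-off even marks at an outgoing contact pair under the ceiling.** For an ordered pair `(i, j)` at contact
(`‖x_i − x_j‖ = ε_N`) of an OUTGOING configuration `w` with `ρ_r(w, x_i) ≤ 2` and `4σ³ ≤ η_c`, with `n̂ = ε_N⁻¹ n`
and the pre-collisional velocities `(v_i⁻, v_j⁻) = reflectVel n (v_i, v_j)`: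
`g(σ³ρ_r(x_i)) · Ξ^{ab}(n̂, v_i⁻, v_j⁻) = ‖Δv_i‖ ω_a ω_b`
(`g = 1`, `⟪v_j⁻ − v_i⁻, n̂⟫ = ⟪v_i − v_j, n̂⟫ = ‖Δv_i‖ ≥ 0` and `n̂ = ω` at contact). [folklore] -/
private theorem cutoff_mul_evenMark_pre_eqA {σ : ℝ} (hσ : 0 < σ) {ηc r : ℝ} (hηc : 0 < ηc)
    (hσc : 4 * σ ^ 3 ≤ ηc) {N : ℕ} {w : Cfg N} {i j : Fin (N + 1)}
    (hcontact : ‖sepV N w i j‖ = hsDiameter σ N) (hout : 0 < ⟪sepV N w i j, (w i).2 - (w j).2⟫_ℝ)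
    (hρ : mollDensity r w (w i).1 ≤ 2) (a b : Fin 3) :
    max 0 (min 1 (2 - 2 * (σ ^ 3 * mollDensity r w (w i).1) / ηc)) *
        evenMark a b ((hsDiameter σ N)⁻¹ • sepV N w i j,
          (reflectVel (sepV N w i j) ((w i).2, (w j).2)).1,
          (reflectVel (sepV N w i j) ((w i).2, (w j).2)).2) =
      ‖dV N w i j‖ * (omg N w i j a * omg N w i j b) := by
  rw [windowCutoff_ceiling_eq_oneA hσ hηc hσc hρ, one_mul]
  have hε : 0 < hsDiameter σ N := hsDiameter_pos hσ N
  have hn0 : sepV N w i j ≠ 0 := by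
    intro h; rw [h, norm_zero] at hcontact; exact hε.ne hcontact
  have hω : omg N w i j = (hsDiameter σ N)⁻¹ • sepV N w i j := by rw [omg, hcontact]
  set c : ℝ := ⟪(w i).2 - (w j).2, omg N w i j⟫_ℝ with hcdef
  have hc_eq : c = (hsDiameter σ N)⁻¹ * ⟪sepV N w i j, (w i).2 - (w j).2⟫_ℝ := by
    rw [hcdef, hω, inner_smul_right, real_inner_comm]
  have hcpos : 0 < c := by rw [hc_eq]; exact mul_pos (inv_pos.2 hε) hout
  have hdv : ‖dV N w i j‖ = c := by
    rw [norm_dV_eq hn0, ← hcdef, abs_of_pos hcpos]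
  -- the reflection flips the normal component of the relative velocity
  have hrefl : ⟪(reflectVel (sepV N w i j) ((w i).2, (w j).2)).2 -
      (reflectVel (sepV N w i j) ((w i).2, (w j).2)).1, (hsDiameter σ N)⁻¹ • sepV N w i j⟫_ℝ = c := by
    rw [inner_smul_right, ← neg_sub (reflectVel (sepV N w i j) ((w i).2, (w j).2)).1, inner_neg_left,
      real_inner_comm, inner_reflectVel_fst_sub_snd (sepV N w i j) hn0, neg_neg, hc_eq]
  simp only [evenMark]
  rw [hrefl, max_eq_left hcpos.le, ← hω, hdv]

/-- **The one-collision identity for the weight `A`.** For an ordered pair `(i, j)` at contact of an outgoing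
configuration `w`, under the ceiling `ρ_r(w, x_i) ≤ 2` and `4σ³ ≤ η_c`: the `A`-weighted flux-form mark is
`markA σ A N s w i j = (ε_N/2) Σ_ab A(s, x_i)_ab g(σ³ρ_r(x_i)) Ξ^{ab}(n̂, v_i⁻, v_j⁻)`. [folklore] -/
private theorem markA_eq_cutoff_evenMark_sumA {σ : ℝ} (hσ : 0 < σ) {ηc r : ℝ} (hηc : 0 < ηc)
    (hσc : 4 * σ ^ 3 ≤ ηc) {N : ℕ} {w : Cfg N} {i j : Fin (N + 1)}
    (hcontact : ‖sepV N w i j‖ = hsDiameter σ N) (hout : 0 < ⟪sepV N w i j, (w i).2 - (w j).2⟫_ℝ)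
    (hρ : mollDensity r w (w i).1 ≤ 2) (A : ℝ → T3 → Fin 3 → Fin 3 → ℝ) (s : ℝ) :
    markA σ A N s w i j =
      hsDiameter σ N / 2 * ∑ a : Fin 3, ∑ b : Fin 3,
        A s (w i).1 a b * max 0 (min 1 (2 - 2 * (σ ^ 3 * mollDensity r w (w i).1) / ηc)) *
          evenMark a b ((hsDiameter σ N)⁻¹ • sepV N w i j,
            (reflectVel (sepV N w i j) ((w i).2, (w j).2)).1,
            (reflectVel (sepV N w i j) ((w i).2, (w j).2)).2) := by
  simp only [mul_assoc, cutoff_mul_evenMark_pre_eqA hσ hηc hσc hcontact hout hρ, markA, Finset.mul_sum]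
  refine Finset.sum_congr rfl fun a _ => Finset.sum_congr rfl fun b _ => ?_
  ring

end OnePairA

/-- Swapping a finite double sum over two `Fintype`s with a finite collision double sum. [folklore] -/
private theorem sum_sum_fintype_swapA {ι κ α β : Type*} [Fintype α] [Fintype β] (T : Finset ι)
    (P : ι → Finset κ) (f : α → β → ι → κ → ℝ) :
    ∑ tc ∈ T, ∑ p ∈ P tc, ∑ a, ∑ b, f a b tc p = ∑ a, ∑ b, ∑ tc ∈ T, ∑ p ∈ P tc, f a b tc p := by
  calc ∑ tc ∈ T, ∑ p ∈ P tc, ∑ a, ∑ b, f a b tc p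
      = ∑ tc ∈ T, ∑ a, ∑ b, ∑ p ∈ P tc, f a b tc p := by
        refine Finset.sum_congr rfl fun tc _ => ?_
        rw [Finset.sum_comm]
        exact Finset.sum_congr rfl fun a _ => Finset.sum_comm
    _ = ∑ a, ∑ tc ∈ T, ∑ b, ∑ p ∈ P tc, f a b tc p := Finset.sum_comm
    _ = ∑ a, ∑ b, ∑ tc ∈ T, ∑ p ∈ P tc, f a b tc p :=
        Finset.sum_congr rfl fun a _ => Finset.sum_comm

/-! ## The registered stub -/

/-- **Registered stub [DψA] `stub_markSumA_eq_evenCollisionSums` — the window increment of the `A`-weighted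
flux-form mark sum is one half of the `(a, b)`-sum of the window increments of the even collision sums.** Fix
`0 < σ ≤ 1/2`, a cutoff level `η_c > 0`, a mollification radius `r > 0`, a flow family, `N`, a GOOD initial datum `z`
and a horizon `t` with the mollified ceiling `ρ_r(Φ_s z, x) ≤ 2` on `[0, t]` and `4σ³ ≤ η_c`. Then for every matrix
weight `A` (no regularity needed: both sides read `A` verbatim) and `0 ≤ τ ≤ τ' ≤ t`,
`M_N^A(τ') − M_N^A(τ) = ½ Σ_{a b} (K_ab(τ') − K_ab(τ))` with
`K_ab(τ) = collisionSum σ N (Φ N) τ (A_ab) g Ξ^{ab} r z`, `g(a) = max 0 (min 1 (2 − 2a/η_c))`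
(collision by collision on the good orbit: outgoing post-collisional pairs, `reflectVel` recovers the incoming
velocities, `Ξ^{ab}(n̂, v_i⁻, v_j⁻) = ‖Δv_i‖ ω_a ω_b`, `g(σ³ρ_r) = 1` under the ceiling).
[folklore; Chapman–Cowling (1970) Ch. 16] -/
theorem stub_markSumA_eq_evenCollisionSums : ∀ (σ : ℝ), 0 < σ → σ ≤ 1 / 2 → ∀ (ηc r : ℝ), 0 < ηc → 0 < r → ∀ (Φ : Flows σ) (N : ℕ) (z : Cfg N), z ∈ (Φ N).good → ∀ t : ℝ, (∀ s ∈ Icc 0 t, ∀ x : T3, Literature.MathematicalPhysics.KineticTheory.mollDensity r ((Φ N).flow s z) x ≤ 2) → 4 * σ ^ 3 ≤ ηc → ∀ (A : ℝ → T3 → Fin 3 → Fin 3 → ℝ) (τ τ' : ℝ), 0 ≤ τ → τ ≤ τ' → τ' ≤ t → MfunA σ Φ A N z τ' - MfunA σ Φ A N z τ = 1 / 2 * ∑ a : Fin 3, ∑ b : Fin 3, (Literature.MathematicalPhysics.KineticTheory.collisionSum σ N (Φ N) τ' (fun p : ℝ × T3 => A p.1 p.2 a b) (fun a : ℝ =>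 max 0 (min 1 (2 - 2 * a / ηc))) (Literature.MathematicalPhysics.KineticTheory.evenMark a b) r z - Literature.MathematicalPhysics.KineticTheory.collisionSum σ N (Φ N) τ (fun p : ℝ × T3 => A p.1 p.2 a b) (fun a : ℝ => max 0 (min 1 (2 - 2 * a / ηc))) (Literature.MathematicalPhysics.KineticTheory.evenMark a b) r z) := by
  intro σ hσ _hσ2 ηc r hηc _hr Φ N z hz t hceil hσc A τ τ' hτ hττ' hτ't
  have htraj := (Φ N).isTrajectory z hz
  -- the kernel of `K_ab` as a collision pair sum along the flow
  set gK : Fin 3 → Fin 3 → ℝ → Cfg N → Fin (N + 1) → Fin (N + 1) → ℝ := fun a b s w i j =>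
    A s (w i).1 a b * max 0 (min 1 (2 - 2 * (σ ^ 3 * mollDensity r w (w i).1) / ηc)) *
      evenMark a b ((hsDiameter σ N)⁻¹ • sepV N w i j,
        (reflectVel (sepV N w i j) ((w i).2, (w j).2)).1,
        (reflectVel (sepV N w i j) ((w i).2, (w j).2)).2) with hgK
  -- `K_ab(τ) = ε/(N+1) · CPS(Icc 0 τ) gK_ab`
  have hK : ∀ (a b : Fin 3) (τ : ℝ),
      Literature.MathematicalPhysics.KineticTheory.collisionSum σ N (Φ N) τ
        (fun p : ℝ × T3 => A p.1 p.2 a b)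
        (fun a : ℝ => max 0 (min 1 (2 - 2 * a / ηc))) (evenMark a b) r z =
      hsDiameter σ N / ((N : ℝ) + 1) * (Φ N).collisionPairSum (Icc 0 τ) (gK a b) z := by
    intro a b τ
    rw [(Φ N).collisionPairSum_eq_finsum_ite hz]
    rfl
  -- window differences of `K_ab`
  have hKdiff : ∀ (a b : Fin 3),
      Literature.MathematicalPhysics.KineticTheory.collisionSum σ N (Φ N) τ'
          (fun p : ℝ × T3 => A p.1 p.2 a b)
          (fun a : ℝ => max 0 (min 1 (2 - 2 * a / ηc))) (evenMark a b) r z -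
        Literature.MathematicalPhysics.KineticTheory.collisionSum σ N (Φ N) τ
          (fun p : ℝ × T3 => A p.1 p.2 a b)
          (fun a : ℝ => max 0 (min 1 (2 - 2 * a / ηc))) (evenMark a b) r z =
      hsDiameter σ N / ((N : ℝ) + 1) * (Φ N).collisionPairSum (Ioc τ τ') (gK a b) z := by
    intro a b
    have hdisj : Disjoint (Icc 0 τ) (Ioc τ τ') :=
      Set.disjoint_left.2 fun x hx1 hx2 => (not_lt.2 hx1.2) hx2.1
    rw [hK, hK]
    unfold HardSphereFlow.collisionPairSum
    rw [← Icc_union_Ioc_eq_Icc hτ hττ', collisionPairSum_union (htraj.locFinite 0 τ)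
      (htraj.finite_collisionTimes_inter_Ioc τ τ') hdisj]
    ring
  -- the window identity, collision by collision
  have hfin := htraj.finite_collisionTimes_inter_Ioc τ τ'
  have hmain : (Φ N).collisionPairSum (Ioc τ τ') (markA σ A N) z =
      hsDiameter σ N / 2 * ∑ a : Fin 3, ∑ b : Fin 3, (Φ N).collisionPairSum (Ioc τ τ') (gK a b) z := by
    unfold HardSphereFlow.collisionPairSum
    simp only [collisionPairSum_eq_finset_sum hfin]
    have htime : ∀ tc ∈ hfin.toFinset,
        ∀ p ∈ contactPairs (Torus.geometry (Fin 3)) (hsDiameter σ N) ((Φ N).flow tc z),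
          markA σ A N tc ((Φ N).flow tc z) p.1 p.2 =
            hsDiameter σ N / 2 * ∑ a : Fin 3, ∑ b : Fin 3, gK a b tc ((Φ N).flow tc z) p.1 p.2 := by
      intro tc htc p hp
      obtain ⟨-, htcI⟩ := (Set.Finite.mem_toFinset hfin).1 htc
      have hs : tc ∈ Icc 0 t := ⟨hτ.trans htcI.1.le, htcI.2.trans hτ't⟩
      obtain ⟨hne, hcs⟩ := mem_contactPairs.1 hp
      have hout : 0 < ⟪sepV N ((Φ N).flow tc z) p.1 p.2,
          ((Φ N).flow tc z p.1).2 - ((Φ N).flow tc z p.2).2⟫_ℝ :=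
        htraj.isOutgoing_of_mem_contactSet hne hcs
      have hcontact : ‖sepV N ((Φ N).flow tc z) p.1 p.2‖ = hsDiameter σ N := hcs.2
      exact markA_eq_cutoff_evenMark_sumA hσ hηc hσc hcontact hout (hceil tc hs _) A tc
    rw [Finset.sum_congr rfl fun tc htc => Finset.sum_congr rfl fun p hp => htime tc htc p hp]
    simp only [← Finset.mul_sum]
    rw [sum_sum_fintype_swapA]
  -- assemble
  have hL : MfunA σ Φ A N z τ' - MfunA σ Φ A N z τ =
      ((N : ℝ) + 1)⁻¹ * (hsDiameter σ N / 2 *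
        ∑ a : Fin 3, ∑ b : Fin 3, (Φ N).collisionPairSum (Ioc τ τ') (gK a b) z) := by
    unfold MfunA
    rw [collisionPairSum_Ioc_split Φ hz hτ hττ' (markA σ A N), ← hmain]
    ring
  rw [hL]
  simp only [hKdiff, ← Finset.mul_sum]
  ring

end

end Summit.AtomisticToContinuum.HydrodynamicLimit.Theorems.HemisphereAffineSlaving
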